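import Literature.Barriers.Parity.SiegelZeroDichotomyChowlaStep3BetaMajorant
import Literature.Barriers.Parity.SiegelZeroDichotomyChowlaStep3Mertens
import Mathlib.NumberTheory.EulerProduct.Basic
import HarnessLib

/-!
# Step (iii) of Tao–Teräväinen at `k = 0`: the Euler product bound (6.6) for the majorant
# weights, `Σ_{d ≤ D} τ(d)^A v_s(d)/d ≪_{A,P} (|s| log R)^{O_{A,P}(1)}`

Topic `Literature/Barriers/Parity`, sub-namespace `TaoTeravainen`; a file of the proof DAG of
`Literature.Barriers.Parity.TaoTeravainen2021_chowla`, towards `TaoTeravainen2021_lemma61`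
(Lemma 6.1, the bound (6.6)). Everything here is PROVED.

The source: "We use Fubini's theorem and Euler product expansion (2.5) to bound
`Σ_{d ≤ D} τ(d)^A α(d)/d ≪ ∫_ℝ Π_{p ≤ R}(1 + Σ_{j=1}^∞ (1+j)^A (exp(O(a_{t,p^j})) - 1)/p^j) |f(t)| dt`.
For `j ≥ 2` we use the crude bound `exp(O(a_{t,p^j})) ≪ j^{O(1)} p^{O(j/log R)} ≪ e^{O(j)}` for `p ≤ R`
to conclude that `Σ_{j=2}^∞ (1+j)^A (exp(O(a_{t,p^j}))-1)/p^j ≪_A 1/p²` … For `j = 1` we have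
`exp(O(a_{t,p^j})) ≤ 1 + O(min((1+|t|) log_R p, 1))`, and thus using `1 + x ≤ e^x` …
From Mertens' theorem (3.3) we have `Π_{p≤R} exp(O_A(min((1+|t|)log_R p,1)/p + 1/p²)) ≪ (2+|t|)^{O_A(1)}`."
[cite: TaoTeravainen2021, §6, proof of Lemma 6.1 (proof of (6.6))]

Here, for the weights `vMaj s P N` of `SiegelZeroDichotomyChowlaStep3BetaMajorant.lean`
(`N = ⌊R⌋₊ + 1`), with Mathlib's Euler product over smooth numbers
(`EulerProduct.summable_and_hasSum_smoothNumbers_prod_primesBelow_tsum`) and the sibling file's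
(3.3) (`sum_min_div_prime_le`) and tail bound (`exists_tail_bound`):

* `eulerWeight s A P d = τ(d)^A (Π_{p^k ∥ d} (exp(P bExp(s,p,k)) - 1))/d`, multiplicative on coprime
  arguments, `= τ(d)^A vMaj(d)/d` on smooth `d`;
* the local bounds at `k = 1` (`≤ 2^A P e^{3P} · 5 min(|s| log p, 1)/p`) and `k ≥ 2`
  (`≤ (2k+1)^{⌈A⌉+P} p^{-3k/4}` when `P · Re s ≤ 1/4`);
* **`exists_sum_tau_rpow_mul_vMaj_div_le`** — for `A ≥ 1`, `P ≥ 1` there are `K, c` with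
  `Σ_{d ∈ [1, D']} τ(d)^A vMaj s P N d / d ≤ K (‖s‖ log R)^c` for all `R ≥ 2`, `D'`, and `s` with
  `0 ≤ Re s`, `(Re s) log R ≤ 1`, `P Re s ≤ 1/4`, `1 ≤ ‖s‖ log R`.
  [cite: TaoTeravainen2021, §6, proof of Lemma 6.1 (proof of (6.6)), with (2.5) and (3.3)]
-/

noncomputable section

open Finset Real

namespace Literature.Barriers.Parity.TaoTeravainen

/-! ### The Euler weight and its multiplicativity -/

/-- The full (not truncated to smooth numbers) product weight `Π_{p^k ∥ d} (exp(P bExp(s,p,k)) - 1)`.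
[cite: TaoTeravainen2021, §6, proof of Lemma 6.1] -/
def vFull (s : ℂ) (P d : ℕ) : ℝ :=
  ∏ p ∈ d.primeFactors, (Real.exp (P * bExp s p (d.factorization p)) - 1)

/-- `vMaj = vFull` on `ℕ_(<N)`-smooth numbers and `0` otherwise. [folklore] -/
theorem vMaj_eq (s : ℂ) (P N d : ℕ) :
    vMaj s P N d = if d ∈ N.smoothNumbers then vFull s P d else 0 := rfl

/-- `vFull ≥ 0` for `Re s ≥ 0`. [folklore] -/
theorem vFull_nonneg {s : ℂ} (hs : 0 ≤ s.re) (P d : ℕ) : 0 ≤ vFull s P d := by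
  refine Finset.prod_nonneg fun p _ => ?_
  have : 0 ≤ (P : ℝ) * bExp s p (d.factorization p) := mul_nonneg (Nat.cast_nonneg _) (bExp_nonneg hs _ _)
  linarith [Real.add_one_le_exp ((P : ℝ) * bExp s p (d.factorization p))]

/-- `vFull` is multiplicative on coprime arguments. [folklore] -/
theorem vFull_mul {s : ℂ} {P a b : ℕ} (ha : a ≠ 0) (hb : b ≠ 0) (hab : a.Coprime b) :
    vFull s P (a * b) = vFull s P a * vFull s P b := by
  unfold vFull
  rw [hab.primeFactors_mul, Finset.prod_union hab.disjoint_primeFactors]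
  congr 1
  · refine Finset.prod_congr rfl fun p hp => ?_
    have hpb : ¬ p ∣ b := fun hdvd => by
      have hpa : p ∣ a := Nat.dvd_of_mem_primeFactors hp
      have h1 : p ∣ 1 := by rw [← hab.gcd_eq_one]; exact Nat.dvd_gcd hpa hdvd
      exact (Nat.prime_of_mem_primeFactors hp).ne_one (Nat.dvd_one.mp h1)
    rw [Nat.factorization_mul ha hb, Finsupp.add_apply, Nat.factorization_eq_zero_of_not_dvd hpb,
      add_zero]
  · refine Finset.prod_congr rfl fun p hp => ?_
    have hpa : ¬ p ∣ a := fun hdvd => by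
      have hpb : p ∣ b := Nat.dvd_of_mem_primeFactors hp
      have h1 : p ∣ 1 := by rw [← hab.gcd_eq_one]; exact Nat.dvd_gcd hdvd hpb
      exact (Nat.prime_of_mem_primeFactors hp).ne_one (Nat.dvd_one.mp h1)
    rw [Nat.factorization_mul ha hb, Finsupp.add_apply, Nat.factorization_eq_zero_of_not_dvd hpa,
      zero_add]

/-- The Euler weight `τ(d)^A vFull(d)/d`. [cite: TaoTeravainen2021, §6, proof of Lemma 6.1] -/
def eulerWeight (s : ℂ) (A : ℝ) (P d : ℕ) : ℝ :=
  (#d.divisors : ℝ) ^ A * vFull s P d / d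

/-- `eulerWeight 1 = 1`. [folklore] -/
theorem eulerWeight_one (s : ℂ) (A : ℝ) (P : ℕ) : eulerWeight s A P 1 = 1 := by
  simp [eulerWeight, vFull]

/-- `eulerWeight ≥ 0`. [folklore] -/
theorem eulerWeight_nonneg {s : ℂ} (hs : 0 ≤ s.re) (A : ℝ) (P d : ℕ) : 0 ≤ eulerWeight s A P d := by
  unfold eulerWeight
  exact div_nonneg (mul_nonneg (by positivity) (vFull_nonneg hs P d)) (Nat.cast_nonneg d)

/-- `eulerWeight` is multiplicative on coprime arguments (`τ`, `vFull` and `d ↦ 1/d` are).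
[folklore] -/
theorem eulerWeight_mul {s : ℂ} (A : ℝ) (P : ℕ) {a b : ℕ} (hab : a.Coprime b) :
    eulerWeight s A P (a * b) = eulerWeight s A P a * eulerWeight s A P b := by
  rcases Nat.eq_zero_or_pos a with rfl | ha
  · simp [eulerWeight]
  rcases Nat.eq_zero_or_pos b with rfl | hb
  · simp [eulerWeight]
  unfold eulerWeight
  rw [Nat.Coprime.card_divisors_mul hab, Nat.cast_mul, Real.mul_rpow (Nat.cast_nonneg _) (Nat.cast_nonneg _),
    vFull_mul ha.ne' hb.ne' hab, Nat.cast_mul]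
  field_simp

/-! ### Values at prime powers -/

/-- `vFull(p^k) = exp(P bExp(s,p,k)) - 1` for `k ≥ 1`. [folklore] -/
theorem vFull_prime_pow (s : ℂ) (P : ℕ) {p : ℕ} (hp : p.Prime) {k : ℕ} (hk : k ≠ 0) :
    vFull s P (p ^ k) = Real.exp (P * bExp s p k) - 1 := by
  unfold vFull
  rw [Nat.primeFactors_prime_pow hk hp, Finset.prod_singleton, Nat.Prime.factorization_pow hp,
    Finsupp.single_eq_same]

/-- `eulerWeight(p^k) = (k+1)^A (exp(P bExp(s,p,k)) - 1)/p^k` for `k ≥ 1`. [folklore] -/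
theorem eulerWeight_prime_pow (s : ℂ) (A : ℝ) (P : ℕ) {p : ℕ} (hp : p.Prime) {k : ℕ} (hk : k ≠ 0) :
    eulerWeight s A P (p ^ k) =
      ((k : ℝ) + 1) ^ A * (Real.exp (P * bExp s p k) - 1) / (p : ℝ) ^ k := by
  unfold eulerWeight
  rw [Nat.divisors_prime_pow hp, Finset.card_map, Finset.card_range, vFull_prime_pow s P hp hk]
  push_cast
  ring

/-! ### The local bound at `k = 1` -/

/-- **`k = 1`**: for `Re s ≥ 0` and `(Re s) log p ≤ 1` (i.e. `p ≤ R`),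
`eulerWeight(p) ≤ 2^A P e^{3P} · 5 min(‖s‖ log p, 1)/p` ("`exp(O(a_{t,p})) ≤ 1 + O(min((1+|t|) log_R p, 1))`").
[cite: TaoTeravainen2021, §6, proof of Lemma 6.1 (the terms `j = 1`)] -/
theorem eulerWeight_prime_le {s : ℂ} (hs : 0 ≤ s.re) {p : ℕ} (hp : p.Prime)
    (hsp : s.re * Real.log p ≤ 1) (A : ℝ) (P : ℕ) :
    eulerWeight s A P p ≤
      (2 : ℝ) ^ A * ((P : ℝ) * Real.exp (3 * P)) * (5 * min (‖s‖ * Real.log p) 1) / p := by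
  have hp0 : (0 : ℝ) < p := by exact_mod_cast hp.pos
  have h := eulerWeight_prime_pow s A P hp one_ne_zero
  rw [pow_one] at h
  rw [h]
  simp only [Nat.cast_one, pow_one]
  set b := bExp s p 1 with hb
  have hb0 : 0 ≤ b := bExp_nonneg hs p 1
  set δ := ‖s‖ * Real.log p with hδ
  have hδ0 : 0 ≤ δ := mul_nonneg (norm_nonneg _) (Real.log_natCast_nonneg p)
  -- `b ≤ 3` and `b ≤ 5 min(δ, 1)`
  have hb3 : b ≤ 3 := by
    have h1 := bExp_le_crude s p one_ne_zero
    have hlog3 : Real.log 3 ≤ 2 := by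
      have := Real.log_le_sub_one_of_pos (show (0 : ℝ) < 3 by norm_num); linarith
    norm_num at h1
    linarith
  have hbmin : b ≤ 5 * min δ 1 := by
    rw [mul_min_of_nonneg _ _ (by norm_num : (0 : ℝ) ≤ 5), mul_one]
    refine le_min ?_ (by linarith)
    have := bExp_le_fine s p one_ne_zero
    simp only [Nat.cast_one, one_pow, mul_one] at this
    linarith
  -- `e^{Pb} - 1 ≤ P b e^{Pb} ≤ P e^{3P} b`
  have hPb0 : 0 ≤ (P : ℝ) * b := mul_nonneg (Nat.cast_nonneg _) hb0
  -- `e^y - 1 ≤ y e^y` (from `1 - y ≤ e^{-y}`)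
  have hexp1 : ∀ y : ℝ, Real.exp y - 1 ≤ y * Real.exp y := fun y => by
    have h1 : -y + 1 ≤ Real.exp (-y) := Real.add_one_le_exp (-y)
    have h2 : 0 < Real.exp y := Real.exp_pos y
    have h3 : Real.exp y * Real.exp (-y) = 1 := by rw [← Real.exp_add, add_neg_cancel, Real.exp_zero]
    nlinarith [mul_le_mul_of_nonneg_left h1 h2.le]
  have hexp : Real.exp (P * b) - 1 ≤ (P : ℝ) * Real.exp (3 * P) * b := by
    calc Real.exp (P * b) - 1 ≤ (P * b) * Real.exp (P * b) := hexp1 _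
      _ ≤ (P * b) * Real.exp (3 * P) := by
          refine mul_le_mul_of_nonneg_left (Real.exp_le_exp.mpr ?_) hPb0
          nlinarith [Nat.cast_nonneg (α := ℝ) P]
      _ = (P : ℝ) * Real.exp (3 * P) * b := by ring
  have h2A : (1 : ℝ) + 1 = 2 := by norm_num
  rw [h2A, div_le_div_iff_of_pos_right hp0]
  calc (2 : ℝ) ^ A * (Real.exp (P * b) - 1) ≤ (2 : ℝ) ^ A * ((P : ℝ) * Real.exp (3 * P) * b) :=
        mul_le_mul_of_nonneg_left hexp (by positivity)
    _ ≤ (2 : ℝ) ^ A * ((P : ℝ) * Real.exp (3 * P) * (5 * min δ 1)) := by gcongr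
    _ = (2 : ℝ) ^ A * ((P : ℝ) * Real.exp (3 * P)) * (5 * min δ 1) := by ring

/-! ### The local bound at `k ≥ 2` -/

/-- **`k ≥ 2`**: for `Re s ≥ 0`, `P · Re s ≤ 1/4` and any prime `p`,
`eulerWeight(p^k) ≤ (2k+1)^{⌈A⌉+P} p^{-3k/4}` ("the crude bound
`exp(O(a_{t,p^j})) ≪ j^{O(1)} p^{O(j/log R)}`"). [cite: TaoTeravainen2021, §6, proof of Lemma 6.1 (the terms `j ≥ 2`)] -/
theorem eulerWeight_prime_pow_le {s : ℂ} (hs : 0 ≤ s.re) {P : ℕ} (hPσ : (P : ℝ) * s.re ≤ 1 / 4)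
    {p : ℕ} (hp : p.Prime) {A : ℝ} (hA : 0 ≤ A) {k : ℕ} (hk : 1 ≤ k) :
    eulerWeight s A P (p ^ k) ≤ (2 * k + 1 : ℝ) ^ (⌈A⌉₊ + P) * (p : ℝ) ^ (-(3 : ℝ) / 4 * k) := by
  have hp1 : (1 : ℝ) ≤ p := by exact_mod_cast hp.one_lt.le
  have hp0 : (0 : ℝ) < p := by linarith
  have hk0 : k ≠ 0 := by omega
  rw [eulerWeight_prime_pow s A P hp hk0]
  have hk1' : (1 : ℝ) ≤ k := by exact_mod_cast hk
  have hk1 : (1 : ℝ) ≤ 2 * k + 1 := by linarith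
  -- `(k+1)^A ≤ (2k+1)^{⌈A⌉}`
  have h1 : ((k : ℝ) + 1) ^ A ≤ (2 * k + 1 : ℝ) ^ (⌈A⌉₊ : ℕ) := by
    calc ((k : ℝ) + 1) ^ A ≤ (2 * k + 1 : ℝ) ^ A :=
          Real.rpow_le_rpow (by positivity) (by linarith) hA
      _ ≤ (2 * k + 1 : ℝ) ^ ((⌈A⌉₊ : ℕ) : ℝ) := Real.rpow_le_rpow_of_exponent_le hk1 (Nat.le_ceil A)
      _ = (2 * k + 1 : ℝ) ^ (⌈A⌉₊ : ℕ) := Real.rpow_natCast _ _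
  -- `e^{P bExp} - 1 ≤ (2k+1)^P p^{Pσk}`
  have h2 : Real.exp (P * bExp s p k) - 1 ≤ (2 * k + 1 : ℝ) ^ P * (p : ℝ) ^ ((P : ℝ) * s.re * k) := by
    have hb := bExp_le_crude s p hk0
    calc Real.exp (P * bExp s p k) - 1 ≤ Real.exp (P * bExp s p k) := by linarith
      _ ≤ Real.exp (P * (Real.log (2 * k + 1) + k * (s.re * Real.log p))) :=
          Real.exp_le_exp.mpr (mul_le_mul_of_nonneg_left hb (Nat.cast_nonneg _))
      _ = (2 * k + 1 : ℝ) ^ P * (p : ℝ) ^ ((P : ℝ) * s.re * k) := by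
          rw [mul_add, Real.exp_add, Real.exp_nat_mul, Real.exp_log (by positivity),
            Real.rpow_def_of_pos hp0]
          congr 1
          congr 1
          ring
  -- `p^{Pσk}/p^k ≤ p^{-3k/4}`
  have h3 : (p : ℝ) ^ ((P : ℝ) * s.re * k) / (p : ℝ) ^ k ≤ (p : ℝ) ^ (-(3 : ℝ) / 4 * k) := by
    rw [← Real.rpow_natCast (p : ℝ) k, ← Real.rpow_sub hp0]
    refine Real.rpow_le_rpow_of_exponent_le hp1 ?_
    have hk' : (0 : ℝ) ≤ k := Nat.cast_nonneg k
    nlinarith [mul_le_mul_of_nonneg_right hPσ hk']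
  have hpk : (0 : ℝ) < (p : ℝ) ^ k := by positivity
  calc ((k : ℝ) + 1) ^ A * (Real.exp (P * bExp s p k) - 1) / (p : ℝ) ^ k
      ≤ (2 * k + 1 : ℝ) ^ (⌈A⌉₊ : ℕ) * ((2 * k + 1 : ℝ) ^ P * (p : ℝ) ^ ((P : ℝ) * s.re * k)) /
          (p : ℝ) ^ k := by
        refine div_le_div_of_nonneg_right (mul_le_mul h1 h2 ?_ (by positivity)) hpk.le
        have : 0 ≤ (P : ℝ) * bExp s p k := mul_nonneg (Nat.cast_nonneg _) (bExp_nonneg hs _ _)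
        linarith [Real.add_one_le_exp ((P : ℝ) * bExp s p k)]
    _ = (2 * k + 1 : ℝ) ^ (⌈A⌉₊ + P) * ((p : ℝ) ^ ((P : ℝ) * s.re * k) / (p : ℝ) ^ k) := by
        rw [pow_add]; ring
    _ ≤ (2 * k + 1 : ℝ) ^ (⌈A⌉₊ + P) * (p : ℝ) ^ (-(3 : ℝ) / 4 * k) :=
        mul_le_mul_of_nonneg_left h3 (by positivity)

/-! ### The Euler factor at a prime -/

/-- **The Euler factor**: for a prime `p` with `(Re s) log p ≤ 1` (and `Re s ≥ 0`, `P Re s ≤ 1/4`),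
the series `Σ_k eulerWeight(p^k)` is summable and
`Σ_k eulerWeight(p^k) ≤ 1 + c₁ min(‖s‖ log p, 1)/p + Z p^{-3/2}`, `c₁ = 5 · 2^A P e^{3P}`, with the
tail constant `Z = Z(⌈A⌉ + P)` of `exists_tail_bound`.
[cite: TaoTeravainen2021, §6, proof of Lemma 6.1 (proof of (6.6))] -/
theorem tsum_eulerWeight_prime_pow_le {s : ℂ} (hs : 0 ≤ s.re) {P : ℕ} (hPσ : (P : ℝ) * s.re ≤ 1 / 4)
    {A : ℝ} (hA : 0 ≤ A) {Z : ℝ}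
    (hZ : ∀ p : ℕ, 2 ≤ p → ∀ u : ℕ → ℝ, (∀ k, 0 ≤ u k) →
      (∀ k : ℕ, 2 ≤ k → u k ≤ (2 * k + 1) ^ (⌈A⌉₊ + P) * (p : ℝ) ^ (-(3 : ℝ) / 4 * k)) →
        Summable (fun k => u (k + 2)) ∧ ∑' k, u (k + 2) ≤ Z * (p : ℝ) ^ (-(3 : ℝ) / 2))
    {p : ℕ} (hp : p.Prime) (hsp : s.re * Real.log p ≤ 1) :
    Summable (fun k => eulerWeight s A P (p ^ k)) ∧
      ∑' k, eulerWeight s A P (p ^ k) ≤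
        1 + (2 : ℝ) ^ A * ((P : ℝ) * Real.exp (3 * P)) * (5 * min (‖s‖ * Real.log p) 1) / p +
          Z * (p : ℝ) ^ (-(3 : ℝ) / 2) := by
  set u : ℕ → ℝ := fun k => eulerWeight s A P (p ^ k) with hu
  have hu0 : ∀ k, 0 ≤ u k := fun k => eulerWeight_nonneg hs A P _
  have hubd : ∀ k : ℕ, 2 ≤ k → u k ≤ (2 * k + 1) ^ (⌈A⌉₊ + P) * (p : ℝ) ^ (-(3 : ℝ) / 4 * k) :=
    fun k hk => eulerWeight_prime_pow_le hs hPσ hp hA (by omega)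
  obtain ⟨htail, htail_le⟩ := hZ p hp.two_le u hu0 hubd
  have hsumm : Summable u := (summable_nat_add_iff (f := u) 2).mp htail
  refine ⟨hsumm, ?_⟩
  rw [← Summable.sum_add_tsum_nat_add 2 hsumm, Finset.sum_range_succ, Finset.sum_range_one]
  have h0 : u 0 = 1 := by simp only [hu, pow_zero]; exact eulerWeight_one s A P
  have h1 : u 1 ≤ (2 : ℝ) ^ A * ((P : ℝ) * Real.exp (3 * P)) * (5 * min (‖s‖ * Real.log p) 1) / p := by
    simp only [hu, pow_one]; exact eulerWeight_prime_le hs hp hsp A P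
  rw [h0]
  linarith

/-! ### The main bound (6.6) for the weights -/

/-- `eulerWeight = τ(d)^A vMaj(d)/d` on `ℕ_(<N)`-smooth `d`, and `τ(d)^A vMaj(d)/d = 0` otherwise.
[folklore] -/
theorem tau_rpow_mul_vMaj_div_eq (s : ℂ) (A : ℝ) (P N d : ℕ) :
    (#d.divisors : ℝ) ^ A * vMaj s P N d / d =
      if d ∈ N.smoothNumbers then eulerWeight s A P d else 0 := by
  rw [vMaj_eq]
  split_ifs
  · rfl
  · simp

set_option maxHeartbeats 800000 in
/-- **(6.6) for the weights — PROVED.** For `A ≥ 0` and `P ≥ 1` there are `K, c ≥ 0` such that for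
all `R ≥ 2`, all `s` with `Re s ≥ 0`, `(Re s) log R ≤ 1`, `P Re s ≤ 1/4`, `1 ≤ ‖s‖ log R`, and all `D'`,
`Σ_{1 ≤ d ≤ D'} τ(d)^A vMaj s P N d / d ≤ K (‖s‖ log R)^c` (`N = ⌊R⌋₊ + 1`): the sum over smooth
`d` is at most the Euler product `Π_{p<N} Σ_k eulerWeight(p^k)` (Mathlib's Euler product over smooth
numbers), whose factors are `≤ 1 + c₁ min(‖s‖ log p, 1)/p + Z p^{-3/2}`, so that the product is
`≤ exp(c₁ (log(‖s‖ log R) + 30) + Z ζ(3/2))` by (3.3). [cite: TaoTeravainen2021, §6, proof of Lemma 6.1 (proof of (6.6)), with (3.3)] -/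
theorem exists_sum_tau_rpow_mul_vMaj_div_le {A : ℝ} (hA : 0 ≤ A) {P : ℕ} (hP1 : 1 ≤ P) :
    ∃ K c : ℝ, 0 ≤ K ∧ 0 ≤ c ∧ ∀ R : ℝ, 2 ≤ R → ∀ s : ℂ, 0 ≤ s.re → s.re * Real.log R ≤ 1 →
      (P : ℝ) * s.re ≤ 1 / 4 → 1 ≤ ‖s‖ * Real.log R → ∀ D' : ℕ,
        ∑ d ∈ Icc 1 D', (#d.divisors : ℝ) ^ A * vMaj s P (⌊R⌋₊ + 1) d / d ≤
          K * (‖s‖ * Real.log R) ^ c := by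
  classical
  obtain ⟨Z, hZ0, hZ⟩ := exists_tail_bound (⌈A⌉₊ + P)
  -- `ζ(3/2)`-type constant
  have hsum32 : Summable (fun n : ℕ => (n : ℝ) ^ (-(3 : ℝ) / 2)) :=
    Real.summable_nat_rpow.mpr (by norm_num)
  set C₀ : ℝ := ∑' n : ℕ, (n : ℝ) ^ (-(3 : ℝ) / 2) with hC₀
  have hC₀0 : 0 ≤ C₀ := tsum_nonneg fun n => by positivity
  set c₁ : ℝ := (2 : ℝ) ^ A * ((P : ℝ) * Real.exp (3 * P)) * 5 with hc₁
  have hc₁0 : 0 ≤ c₁ := by positivity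
  refine ⟨Real.exp (c₁ * 30 + Z * C₀), c₁, (Real.exp_pos _).le, hc₁0, ?_⟩
  intro R hR s hs hsR hPσ hT D'
  set N := ⌊R⌋₊ + 1 with hN
  set T : ℝ := ‖s‖ * Real.log R with hTdef
  have hlogR : 0 < Real.log R := Real.log_pos (by linarith)
  have hR0 : (0 : ℝ) ≤ R := by linarith
  have hM2 : 2 ≤ ⌊R⌋₊ := Nat.le_floor (by exact_mod_cast hR)
  -- Step 1: the sum over `d` is a sum of `eulerWeight` over smooth `d`, hence `≤` the Euler product
  set f : ℕ → ℝ := fun d => eulerWeight s A P d with hf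
  have hf1 : f 1 = 1 := eulerWeight_one s A P
  have hfmul : ∀ {m n : ℕ}, m.Coprime n → f (m * n) = f m * f n := fun hmn => eulerWeight_mul A P hmn
  have hf0 : ∀ d, 0 ≤ f d := fun d => eulerWeight_nonneg hs A P d
  have hfnorm : ∀ d, ‖f d‖ = f d := fun d => Real.norm_of_nonneg (hf0 d)
  -- summability at every prime
  have hprime : ∀ {p : ℕ}, p.Prime → Summable (fun k : ℕ => ‖f (p ^ k)‖) := by
    intro p hp
    have hubd : ∀ k : ℕ, 2 ≤ k → f (p ^ k) ≤ (2 * k + 1) ^ (⌈A⌉₊ + P) * (p : ℝ) ^ (-(3 : ℝ) / 4 * k) :=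
      fun k hk => eulerWeight_prime_pow_le hs hPσ hp hA (by omega)
    obtain ⟨htail, -⟩ := hZ p hp.two_le (fun k => f (p ^ k)) (fun k => hf0 _) hubd
    have := (summable_nat_add_iff (f := fun k => f (p ^ k)) 2).mp htail
    exact this.congr fun k => (hfnorm _).symm
  obtain ⟨hsummable, hhasSum⟩ :=
    EulerProduct.summable_and_hasSum_smoothNumbers_prod_primesBelow_tsum hf1 hfmul hprime N
  have hstep1 : ∑ d ∈ Icc 1 D', (#d.divisors : ℝ) ^ A * vMaj s P N d / d ≤
      ∏ p ∈ N.primesBelow, ∑' k : ℕ, f (p ^ k) := by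
    -- rewrite the summand and drop the non-smooth terms
    have h1 : ∑ d ∈ Icc 1 D', (#d.divisors : ℝ) ^ A * vMaj s P N d / d =
        ∑ d ∈ (Icc 1 D').filter (· ∈ N.smoothNumbers), f d := by
      rw [Finset.sum_filter]
      exact Finset.sum_congr rfl fun d _ => tau_rpow_mul_vMaj_div_eq s A P N d
    rw [h1, ← Finset.sum_subtype_eq_sum_filter]
    refine sum_le_hasSum _ (fun m _ => hf0 _) hhasSum
  -- Step 2: each Euler factor
  have hfactor : ∀ p ∈ N.primesBelow, ∑' k : ℕ, f (p ^ k) ≤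
      1 + (c₁ * (min (‖s‖ * Real.log p) 1 / p) + Z * (p : ℝ) ^ (-(3 : ℝ) / 2)) := by
    intro p hp
    obtain ⟨hpN, hpp⟩ := Nat.mem_primesBelow.mp hp
    have hpR : (p : ℝ) ≤ R := (lt_floor_add_one_iff hpp.one_lt.le R).mp hpN
    have hp1 : (1 : ℝ) ≤ p := by exact_mod_cast hpp.one_lt.le
    have hsp : s.re * Real.log p ≤ 1 :=
      (mul_le_mul_of_nonneg_left (Real.log_le_log (by linarith) hpR) hs).trans hsR
    have h := (tsum_eulerWeight_prime_pow_le hs hPσ hA hZ hpp hsp).2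
    have hp0 : (0 : ℝ) < p := by linarith
    calc ∑' k : ℕ, f (p ^ k) ≤ 1 + (2 : ℝ) ^ A * ((P : ℝ) * Real.exp (3 * P)) *
          (5 * min (‖s‖ * Real.log p) 1) / p + Z * (p : ℝ) ^ (-(3 : ℝ) / 2) := h
      _ = 1 + (c₁ * (min (‖s‖ * Real.log p) 1 / p) + Z * (p : ℝ) ^ (-(3 : ℝ) / 2)) := by
          rw [hc₁]; ring
  have hfactor0 : ∀ p ∈ N.primesBelow, 0 ≤ ∑' k : ℕ, f (p ^ k) :=
    fun p _ => tsum_nonneg fun k => hf0 _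
  -- Step 3: the product is at most `exp(Σ_p (c₁ min/p + Z p^{-3/2}))`
  set x : ℕ → ℝ := fun p => c₁ * (min (‖s‖ * Real.log p) 1 / p) + Z * (p : ℝ) ^ (-(3 : ℝ) / 2) with hx
  have hx0 : ∀ p, 0 ≤ x p := fun p => by positivity
  have hstep3 : ∏ p ∈ N.primesBelow, ∑' k : ℕ, f (p ^ k) ≤ Real.exp (∑ p ∈ N.primesBelow, x p) :=
    (Finset.prod_le_prod hfactor0 hfactor).trans (Real.prod_one_add_le_exp_sum _ hx0)
  -- Step 4: the sums over primes: (3.3) and `Σ p^{-3/2} ≤ C₀`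
  have hminsum : ∑ p ∈ N.primesBelow, min (‖s‖ * Real.log p) 1 / p ≤ Real.log T + 30 := by
    have h := sum_min_div_prime_le hM2 (σ := T) hT (L := Real.log R)
      (Real.log_le_log (by positivity) (Nat.floor_le hR0))
    refine le_trans (le_of_eq (Finset.sum_congr rfl fun p _ => ?_)) h
    congr 2
    rw [hTdef]; field_simp
  have h32 : ∑ p ∈ N.primesBelow, (p : ℝ) ^ (-(3 : ℝ) / 2) ≤ C₀ :=
    hsum32.sum_le_tsum _ (fun n _ => by positivity)
  have hstep4 : ∑ p ∈ N.primesBelow, x p ≤ c₁ * (Real.log T + 30) + Z * C₀ := by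
    simp only [hx]
    rw [Finset.sum_add_distrib, ← Finset.mul_sum, ← Finset.mul_sum]
    exact add_le_add (mul_le_mul_of_nonneg_left hminsum hc₁0) (mul_le_mul_of_nonneg_left h32 hZ0)
  -- assemble: `exp(c₁ (log T + 30) + Z C₀) = exp(30 c₁ + Z C₀) T^{c₁}`
  have hT0 : 0 < T := by linarith
  calc ∑ d ∈ Icc 1 D', (#d.divisors : ℝ) ^ A * vMaj s P N d / d
      ≤ ∏ p ∈ N.primesBelow, ∑' k : ℕ, f (p ^ k) := hstep1
    _ ≤ Real.exp (∑ p ∈ N.primesBelow, x p) := hstep3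
    _ ≤ Real.exp (c₁ * (Real.log T + 30) + Z * C₀) := Real.exp_le_exp.mpr hstep4
    _ = Real.exp (c₁ * 30 + Z * C₀) * T ^ c₁ := by
        rw [Real.rpow_def_of_pos hT0, ← Real.exp_add]
        congr 1; ring

end Literature.Barriers.Parity.TaoTeravainen
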